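import Summits.Ventures.LatticeQCDFlow.Exactness.DoeblinAutocovariance
import HarnessLib

/-!
# From events to observables: a setwise bound controls every observable with values in `[0, 1]`

HONEST FRAMING: exact (Metropolis-corrected) sampling algorithms for lattice gauge theory;
figures of merit are autocorrelation/cost numbers at stated couplings and volumes; no
continuum-physics claim.

Venture `LatticeQCDFlow` (cell pub-lqcd), topic `Exactness`, FANOUT row 9 (eng-latcore, the
engine `latflow.core`).  NEW WORK of the cell over Mathlib's layer-cake formula
(`Integrable.integral_eq_integral_meas_lt`) and row 9's `DoeblinAutocovariance.lean`.  Nothing is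
cited as a fact.  Printed counterpart, NAMED ONLY: Meyn–Tweedie 1993 Thm 16.1.5 /
Levin–Peres–Wilmer Prop. 4.5 (total-variation bounds transfer to bounded functionals).

The Doeblin file bounds `|κᵗ(x, A) − π(A)|` for EVENTS `A`; the scorers' observables (plaquette,
Polyakov, `cos`-charge bins) are bounded FUNCTIONS.  This file makes the transfer once and for all.

## What is proved

* **`abs_integral_sub_integral_le_of_setwise`** — for probability laws `μ, ν` with
  `|μ(A) − ν(A)| ≤ δ` for every measurable `A`, and every measurable `g` with `0 ≤ g ≤ 1`:
  `|∫ g dμ − ∫ g dν| ≤ δ` (layer cake: `∫ g dμ = ∫₀¹ μ{g > t} dt`).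
* **`doeblin_integral_nHit_sub_le`** — for a Doeblin chain (`κ(x,·) ≥ ε ν`, invariant probability
  `π`) and every measurable `0 ≤ g ≤ 1`: `|∫ g dκᵗ(x,·) − ∫ g dπ| ≤ (1 − ε)ᵗ` for EVERY start `x`;
  `heatBathSweep_integral_sub_le` — the heat-bath-sweep instance (`ε = (m/M)^{|l|}`).

Affine rescaling gives any bounded observable (`a ≤ g ≤ b`: multiply the bound by `b − a`); not
written out.  NOT CLAIMED: unbounded observables; reversibility/spectral improvements.
-/

namespace Summit.Ventures.LatticeQCDFlow.Exactness

open MeasureTheory ProbabilityTheory Set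
open scoped ENNReal

section Transfer

variable {Ω : Type*} [MeasurableSpace Ω]

/-- The layer function `t ↦ μ{g > t}` of an observable with values in `[0,1]`: antitone (hence
measurable), bounded by one, and zero from `t = 1` on. -/
theorem layer_eq_zero_of_one_le {μ : Measure Ω} {g : Ω → ℝ} (h1 : ∀ x, g x ≤ 1) {t : ℝ} (ht : 1 ≤ t) :
    μ.real {a | t < g a} = 0 := by
  have : {a | t < g a} = ∅ := eq_empty_of_forall_notMem fun a ha => (lt_irrefl _ ((ht.trans_lt ha).trans_le (h1 a)))
  rw [this, measureReal_empty]

/-- **A setwise bound controls every `[0,1]`-valued observable**: if `|μ(A) − ν(A)| ≤ δ` for all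
measurable `A` (probability laws `μ, ν`), then `|∫ g dμ − ∫ g dν| ≤ δ` for every measurable `g` with
`0 ≤ g ≤ 1`. -/
theorem abs_integral_sub_integral_le_of_setwise {μ ν : Measure Ω} [IsProbabilityMeasure μ]
    [IsProbabilityMeasure ν] {δ : ℝ} (hδ : ∀ A, MeasurableSet A → |μ.real A - ν.real A| ≤ δ)
    {g : Ω → ℝ} (hg : Measurable g) (h0 : ∀ x, 0 ≤ g x) (h1 : ∀ x, g x ≤ 1) :
    |∫ x, g x ∂μ - ∫ x, g x ∂ν| ≤ δ := by
  -- integrability of a `[0,1]`-valued measurable function under a probability law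
  have hint : ∀ (ρ : Measure Ω) [IsProbabilityMeasure ρ], Integrable g ρ := fun ρ _ =>
    (integrable_const (1 : ℝ)).mono' hg.aestronglyMeasurable
      (ae_of_all _ fun x => by rw [Real.norm_eq_abs, abs_of_nonneg (h0 x)]; exact h1 x)
  -- layer cake for both laws
  rw [(hint μ).integral_eq_integral_meas_lt (ae_of_all _ h0), (hint ν).integral_eq_integral_meas_lt (ae_of_all _ h0)]
  -- the layer functions vanish beyond `t = 1`: restrict to `(0, 1]`
  have hsub : Ioc (0 : ℝ) 1 ⊆ Ioi 0 := fun t ht => ht.1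
  have hzero : ∀ (ρ : Measure Ω), ∀ t ∈ Ioi (0 : ℝ) \ Ioc 0 1, ρ.real {a | t < g a} = 0 := fun ρ t ht => by
    have ht1 : 1 ≤ t := le_of_not_gt fun h => ht.2 ⟨ht.1, h.le⟩
    exact layer_eq_zero_of_one_le h1 ht1
  rw [setIntegral_eq_of_subset_of_forall_sdiff_eq_zero measurableSet_Ioi hsub (hzero μ),
    setIntegral_eq_of_subset_of_forall_sdiff_eq_zero measurableSet_Ioi hsub (hzero ν)]
  -- both layer functions are integrable on `(0,1]` (antitone, bounded by one)
  have hmeas : ∀ (ρ : Measure Ω) [IsProbabilityMeasure ρ], Measurable fun t : ℝ => ρ.real {a | t < g a} :=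
    fun ρ _ => Antitone.measurable fun s t hst =>
      measureReal_mono (fun a (ha : t < g a) => lt_of_le_of_lt hst ha) (measure_ne_top _ _)
  have hIO : ∀ (ρ : Measure Ω) [IsProbabilityMeasure ρ],
      IntegrableOn (fun t : ℝ => ρ.real {a | t < g a}) (Ioc 0 1) := fun ρ _ =>
    (integrableOn_const (C := (1 : ℝ)) (hs := measure_Ioc_lt_top.ne)).mono' (hmeas ρ).aestronglyMeasurable
      (ae_of_all _ fun t => by
        rw [Real.norm_eq_abs, abs_of_nonneg measureReal_nonneg]; exact measureReal_le_one)
  rw [← integral_sub (hIO μ) (hIO ν), ← Real.norm_eq_abs]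
  have hvol : (volume : Measure ℝ).real (Ioc 0 1) = 1 := by
    rw [measureReal_def, Real.volume_Ioc, sub_zero, ENNReal.toReal_ofReal zero_le_one]
  calc ‖∫ t in Ioc (0 : ℝ) 1, (μ.real {a | t < g a} - ν.real {a | t < g a})‖
      ≤ δ * (volume : Measure ℝ).real (Ioc 0 1) :=
        norm_setIntegral_le_of_norm_le_const measure_Ioc_lt_top fun t _ => by
          rw [Real.norm_eq_abs]
          exact hδ _ (hg measurableSet_Ioi)
    _ = δ := by rw [hvol, mul_one]

end Transfer

section Doeblin

variable {Ω : Type*} [MeasurableSpace Ω] {κ : Kernel Ω Ω} [IsMarkovKernel κ] {ν : Measure Ω}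
  [IsProbabilityMeasure ν] {ε : ℝ≥0∞} {π : Measure Ω} [IsProbabilityMeasure π]

/-- **Doeblin for observables**: `|∫ g dκᵗ(x,·) − ∫ g dπ| ≤ (1 − ε)ᵗ` for every start `x`, every `t`
and every measurable `g` with values in `[0, 1]`. -/
theorem doeblin_integral_nHit_sub_le (hmin : ∀ x {B : Set Ω}, MeasurableSet B → ε * ν B ≤ κ x B)
    (hε1 : ε ≤ 1) (hπ : Kernel.Invariant κ π) (x : Ω) (t : ℕ) {g : Ω → ℝ} (hg : Measurable g)
    (h0 : ∀ y, 0 ≤ g y) (h1 : ∀ y, g y ≤ 1) :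
    |∫ y, g y ∂(nHit κ t x) - ∫ y, g y ∂π| ≤ (1 - ε.toReal) ^ t := by
  haveI := isMarkovKernel_nHit κ t
  exact abs_integral_sub_integral_le_of_setwise (fun A hA => doeblin_nHit_sub_le hmin hε1 hπ x t A) hg h0 h1

end Doeblin

section HeatBath

variable {ι : Type*} [Fintype ι] [DecidableEq ι] {X : ι → Type*} [∀ i, MeasurableSpace (X i)]
variable {μ : Π i, Measure (X i)} [∀ i, IsProbabilityMeasure (μ i)] {p : (Π j, X j) → ℝ≥0∞}
variable {m M : ℝ≥0∞}

/-- **Heat-bath sweep, observables**: from every start configuration `ω`, after `t` sweeps every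
`[0,1]`-valued measurable observable is within `(1 − (m/M)^{|l|})ᵗ` of its Gibbs mean. -/
theorem heatBathSweep_integral_sub_le (hp : Measurable p) (hm0 : m ≠ 0) (hMtop : M ≠ ∞)
    (hmp : ∀ ω, m ≤ p ω) (hpM : ∀ ω, p ω ≤ M) {l : List ι} (hl : ∀ i, i ∈ l) (ω : Π j, X j) (t : ℕ)
    {g : (Π j, X j) → ℝ} (hg : Measurable g) (h0 : ∀ y, 0 ≤ g y) (h1 : ∀ y, g y ≤ 1) :
    |∫ y, g y ∂(nHit (cycle (l.map (siteHeatBath μ p))) t ω) - ∫ y, g y ∂(piGibbsLaw μ p)| ≤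
      (1 - (m.toReal / M.toReal) ^ l.length) ^ t := by
  haveI := isMarkovKernel_heatBathSweep (μ := μ) hp hm0 hMtop hmp hpM l
  haveI := isProbabilityMeasure_piGibbsLaw (μ := μ) (p := p) hm0 hMtop hmp hpM
  haveI : ∀ i, Nonempty (X i) := fun i => nonempty_of_isProbabilityMeasure (μ i)
  have hmin : ∀ x {B : Set (Π j, X j)}, MeasurableSet B →
      (m * M⁻¹) ^ l.length * Measure.pi μ B ≤ cycle (l.map (siteHeatBath μ p)) x B := fun x B hB => by
    have h := Measure.le_iff.1 (heatBathSweep_minorised (μ := μ) hp hm0 hMtop hmp hpM hl x) B hB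
    rwa [Measure.smul_apply, smul_eq_mul] at h
  have hε1 : (m * M⁻¹) ^ l.length ≤ 1 := by
    refine pow_le_one₀ bot_le ?_
    obtain ⟨ω'⟩ := (inferInstance : Nonempty (Π j, X j))
    calc m * M⁻¹ ≤ M * M⁻¹ := mul_le_mul' ((hmp ω').trans (hpM ω')) le_rfl
      _ ≤ 1 := ENNReal.mul_inv_le_one M
  have h := doeblin_integral_nHit_sub_le hmin hε1
    (heatBathSweep_invariant_piGibbsLaw (μ := μ) hp hm0 hMtop hmp hpM l) ω t hg h0 h1
  rwa [ENNReal.toReal_pow, ENNReal.toReal_mul, ENNReal.toReal_inv, ← div_eq_mul_inv] at h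

end HeatBath

end Summit.Ventures.LatticeQCDFlow.Exactness
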